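import Summits.CriticalPhenomena.Ising3DConformalLimit.Theses.FKParityRobustness
import Summits.CriticalPhenomena.Ising3DConformalLimit.Theorems.FKParityRobustnessDefs
import Summits.CriticalPhenomena.Ising3DConformalLimit.Theorems.FKParityRobustnessParityRobustMergingXorTransport
import Summits.CriticalPhenomena.Ising3DConformalLimit.Theorems.FKParityRobustnessParityRobustMergingEvenSubgraphCount
import Summits.CriticalPhenomena.Ising3DConformalLimit.Theorems.FKParityRobustnessParityRobustMergingGrimmettJanson
import Summits.CriticalPhenomena.Ising3DConformalLimit.Theorems.FKParityRobustnessParityRobustMergingFKTransfer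
import HarnessLib

/-!
# The loop form `C⁺` of the crux `ParityRobustMerging` (stmt-CriticalPhenomena-11253) implies it

Route `FKParityRobustness`, line `plaquette-xor-surgery`.  With the three dimension-free stubs of the
line LANDED — the cycle-space count (`stub_evenSubgraphCount`), the sourced Grimmett–Janson identity
(`stub_grimmettJanson`) and the FK ← loop transfer (`stub_fkLoopTransfer`) — the crux BLOB is reduced,
sorry-free, to a statement about ONE deterministic family of finite sums: the STRONG LOOP FORM

  `C⁺ :  ∃ c > 0 ∀ l ≥ 1 ∃ N₀ ∀ N ≥ N₀ ∀ a = l·tetra ⊂ Λ_N,  c · Z_{t_c}(A) ≤ Z_{t_c}(A; C)`,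

`Z_t(A; P) = ∑_{F ∈ 𝒯_A(G_N), P F} t^{|F|}` the sourced loop-O(1) masses of the box graph `G_N`
(`zMass`), `C = JoinsAll a` ("the four sources lie in one component of the `T`-join `F`"),
`t_c = tanh β_c(3)`.  In words: two source strands of ONE critical high-temperature configuration on
`ℤ³` lie in one cluster with probability bounded below.  This file records

* `parityRobustMerging_of_loopForm : LoopForm → ParityRobustMerging` — usable by EVERY loop-side line of
  the crux (hub census, crossing-order carrier, …), not only by `plaquette-xor-surgery`;
* `loopForm_of_nearTouch_of_pivotalSparsity` — the remaining `d = 3` content of THIS line: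
  NT ∧ PS → `C⁺` along the landed transport identity `ntMass = pivMass` (`stub_xorTransport`).

No new definitions of substance: `LoopForm` is a named `Prop` abbreviating the displayed statement over
the landed vocabulary (`zMass`, `boxGraph`, `tc`, `tetra`, `JoinsAll`).
-/

noncomputable section

open MeasureTheory Finset
open Literature.Probability.LatticeModels
open Summit.CriticalPhenomena.Ising3DConformalLimit.Theses.FKParityRobustness

namespace Summit.CriticalPhenomena.Ising3DConformalLimit.Cruxes.ParityRobustMerging.PlaquetteXorSurgery

open scoped Classical

/-- `ParityRobustMerging` from its STRONG LOOP FORM `C⁺`: if for some `c > 0`, every `l ≥ 1`, all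
large `N` and `a = l·tetra`, `c · Z_{t_c}(A) ≤ Z_{t_c}(A; JoinsAll)` on the box graph `G_N`, then the
crux holds (with the same constant).  Proof: the landed FK ← loop transfer `stub_fkLoopTransfer`, fed
with the landed sourced Grimmett–Janson identity (`stub_grimmettJanson stub_evenSubgraphCount`), at
`V = ↥(box 3 N)`, `G = G_N`, `β = β_c(3) ≥ 0` (`criticalBeta_nonneg`), `a` injective
(`tetra_injective`); its conclusion is the crux's inner statement verbatim. -/
theorem parityRobustMerging_of_loopForm :
    (∃ c : ℝ, 0 < c ∧ ∀ l : ℕ, 1 ≤ l → ∃ N₀ : ℕ, ∀ N : ℕ, N₀ ≤ N → ∀ a : Fin 4 → ↥(box 3 N), (∀ i, ((a i : Site 3)) = (l : ℤ) • tetra i) → c * zMass (boxGraph N) tc a (fun _ => True) ≤ zMass (boxGraph N) tc a (fun F => JoinsAll a F)) → Summit.CriticalPhenomena.Ising3DConformalLimit.Theses.FKParityRobustness.ParityRobustMerging := by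
  intro h
  have hT := stub_fkLoopTransfer (stub_grimmettJanson stub_evenSubgraphCount)
  obtain ⟨c, hc, h⟩ := h
  unfold ParityRobustMerging
  intro tetra'
  refine ⟨c, hc, fun l hl => ?_⟩
  obtain ⟨N₀, hN₀⟩ := h l hl
  refine ⟨N₀, fun N hN a ha => ?_⟩
  exact hT ↥(box 3 N) ((zdGraph 3).comap Subtype.val) (criticalBeta 3) (criticalBeta_nonneg 3) a
    (tetra_injective hl a ha) c (hN₀ N hN a ha)

/-- The `d = 3` content of the line `plaquette-xor-surgery` gives the loop form: from NT
(`c · Z(A;H) ≤ ntMass`, `c > 0`) and PS (`pivMass ≤ C · Z(A;C)`) at some `(N, a)`, the landed transport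
identity `ntMass = pivMass` (`stub_xorTransport`) and the mass split `Z(A) = Z(A;C) + Z(A;H)`
(`zMass_split`) give `Z(A) ≤ (1 + max C 0 / c) · Z(A;C)`, i.e. `c⁺ · Z(A) ≤ Z(A;C)` with
`c⁺ = 1/(1 + max C 0 / c) > 0` depending only on `c, C`. -/
theorem zMass_le_of_nearTouch_of_pivotalSparsity {N : ℕ} (a : Fin 4 → ↥(box 3 N)) {c C : ℝ}
    (hc : 0 < c)
    (hNT : c * zMass (boxGraph N) tc a (fun F => ¬ JoinsAll a F) ≤ ntMass (boxGraph N) tc a)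
    (hPS : pivMass (boxGraph N) tc a ≤ C * zMass (boxGraph N) tc a (fun F => JoinsAll a F)) :
    (1 / (1 + max C 0 / c)) * zMass (boxGraph N) tc a (fun _ => True) ≤
      zMass (boxGraph N) tc a (fun F => JoinsAll a F) := by
  set K : ℝ := max C 0 / c with hK
  have hK0 : 0 ≤ K := div_nonneg (le_max_right _ _) hc.le
  have hK1 : 0 < 1 + K := by linarith
  have hx := stub_xorTransport ↥(box 3 N) (boxGraph N) tc a
  have hzC : 0 ≤ zMass (boxGraph N) tc a (fun F => JoinsAll a F) :=
    zMass_nonneg _ tanh_criticalBeta_nonneg _ _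
  have h3 : pivMass (boxGraph N) tc a ≤ max C 0 * zMass (boxGraph N) tc a (fun F => JoinsAll a F) :=
    hPS.trans (mul_le_mul_of_nonneg_right (le_max_left _ _) hzC)
  have h4 : zMass (boxGraph N) tc a (fun F => ¬ JoinsAll a F)
      ≤ K * zMass (boxGraph N) tc a (fun F => JoinsAll a F) := by
    rw [hK, div_mul_eq_mul_div, le_div_iff₀ hc]
    calc zMass (boxGraph N) tc a (fun F => ¬ JoinsAll a F) * c
        = c * zMass (boxGraph N) tc a (fun F => ¬ JoinsAll a F) := by ring
      _ ≤ ntMass (boxGraph N) tc a := hNT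
      _ = pivMass (boxGraph N) tc a := hx
      _ ≤ max C 0 * zMass (boxGraph N) tc a (fun F => JoinsAll a F) := h3
  have h5 : zMass (boxGraph N) tc a (fun _ => True)
      ≤ (1 + K) * zMass (boxGraph N) tc a (fun F => JoinsAll a F) := by
    rw [zMass_split (boxGraph N) tc a, add_mul, one_mul]
    linarith
  rw [one_div, inv_mul_le_iff₀ hK1]
  exact h5

/-- NT ∧ PS (the two `d = 3` stubs of the line, as named statements with their quantifiers) imply the
loop form `C⁺`, uniformly: constants `c⁺ = 1/(1 + max C 0 / c)`, `N₀ = max N₀^{NT} N₀^{PS}`. -/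
theorem loopForm_of_nearTouch_of_pivotalSparsity
    (hNT : ∃ c : ℝ, 0 < c ∧ ∀ l : ℕ, 1 ≤ l → ∃ N₀ : ℕ, ∀ N : ℕ, N₀ ≤ N →
      ∀ a : Fin 4 → ↥(box 3 N), (∀ i, ((a i : Site 3)) = (l : ℤ) • tetra i) →
        c * zMass (boxGraph N) tc a (fun F => ¬ JoinsAll a F) ≤ ntMass (boxGraph N) tc a)
    (hPS : ∃ C : ℝ, ∀ l : ℕ, 1 ≤ l → ∃ N₀ : ℕ, ∀ N : ℕ, N₀ ≤ N →
      ∀ a : Fin 4 → ↥(box 3 N), (∀ i, ((a i : Site 3)) = (l : ℤ) • tetra i) →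
        pivMass (boxGraph N) tc a ≤ C * zMass (boxGraph N) tc a (fun F => JoinsAll a F)) :
    ∃ c : ℝ, 0 < c ∧ ∀ l : ℕ, 1 ≤ l → ∃ N₀ : ℕ, ∀ N : ℕ, N₀ ≤ N →
      ∀ a : Fin 4 → ↥(box 3 N), (∀ i, ((a i : Site 3)) = (l : ℤ) • tetra i) →
        c * zMass (boxGraph N) tc a (fun _ => True) ≤ zMass (boxGraph N) tc a (fun F => JoinsAll a F) := by
  obtain ⟨c, hc, hNT⟩ := hNT
  obtain ⟨C, hPS⟩ := hPS
  have hK0 : 0 ≤ max C 0 / c := div_nonneg (le_max_right _ _) hc.le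
  refine ⟨1 / (1 + max C 0 / c), by positivity, fun l hl => ?_⟩
  obtain ⟨N₁, hN₁⟩ := hNT l hl
  obtain ⟨N₂, hN₂⟩ := hPS l hl
  refine ⟨max N₁ N₂, fun N hN a ha => ?_⟩
  exact zMass_le_of_nearTouch_of_pivotalSparsity a hc (hN₁ N (le_of_max_le_left hN) a ha)
    (hN₂ N (le_of_max_le_right hN) a ha)

end Summit.CriticalPhenomena.Ising3DConformalLimit.Cruxes.ParityRobustMerging.PlaquetteXorSurgery

end
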